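import Summits.CriticalPhenomena.PercolationContinuityZ3.Theorems.SahiLiebSahiContinuumProduct
import Mathlib.Probability.CDF
import Mathlib.Probability.Distributions.Gaussian.Real

/-!
# The continuous case on `ℝ^d`: product measures with unbounded coordinates, Gaussian vectors

Companion of `SahiLiebSahiContinuumProduct.lean` (cell `prim-sahi`, typer, generation 9; `--supports
stmt-CriticalPhenomena-4575`).  For a probability measure on `ℝ` the quantile transform `u ↦ inf {t : u ≤ F(t)}`
is an honest monotone map only on the OPEN interval `(0,1)`, so a monotone family on `ℝ^d` does not pull back to a
monotone family on the closed cube `Q_d`.  Remedy: pull back along the coordinatewise quantile map on the interior and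
EXTEND the pulled-back family to the faces (`0` on `u_j = 0`, the bound `M` on `u_j = 1`); the extension is monotone
on `Q_d` and agrees with the pull-back Lebesgue-a.e., so the moments (hence `E_n`) are unchanged.  This needs BOUNDED
families — the only new hypothesis.  Proved:
* `RealQuantile.rq μ u = inf {t : u ≤ F_μ(t)}` (Mathlib's `ProbabilityTheory.cdf`): Galois property and monotonicity
  on `(0,1)`, measurability on `[0,1]`, `RealQuantile.map_rqI_volume` (it pushes Lebesgue measure of `[0,1]` to `μ`);
* `msahiE_pi_real_nonneg_of_liebSahiContinuum` (`…_antitone`), `msahiE_map_pi_real_nonneg_of_liebSahiContinuum` —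
  `LiebSahiContinuum d n ⇒ E_n ≥ 0` under EVERY product probability measure on `ℝ^d` and every monotone measurable
  image of one, for bounded nonnegative monotone measurable families;
* UNCONDITIONALLY (`d ≤ 2`): `msahiE_pi_real_nonneg_of_le_two`, `msahiE_prod_real_nonneg_of_monotone` (`…_antitone`),
  `msahiE_map_prod_real_nonneg` — **every product probability measure `μ₁ ⊗ μ₂` on `ℝ²` (and every monotone image)
  is Sahi-positive of every order** for bounded measurable families;
* GAUSSIAN VECTORS `X = A Z + c`, `A ≥ 0` entrywise, `Z` independent Gaussians: a monotone image of a product measure,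
  so `LiebSahiContinuum d n ⇒ E_n ≥ 0` (`msahiE_gaussian_mulVec_nonneg_of_liebSahiContinuum`); UNCONDITIONAL for
  `d ≤ 2` sources (`msahiE_gaussian_mulVec_nonneg_of_le_two`), in particular `msahiE_bivariateGaussian_nonneg`: every
  bivariate Gaussian with nonnegative correlation satisfies Sahi's `E_n ≥ 0` for EVERY `n` and all bounded nonnegative
  monotone measurable `f_i : ℝ² → ℝ` (Pitt 1982 = the order `n = 2`).
Nothing here asserts `LiebSahiContinuum d n` for `d ≥ 3`.
-/

noncomputable section

namespace Summit.CriticalPhenomena.PercolationContinuityZ3.Theorems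

open MeasureTheory ProbabilityTheory Set Filter Topology Literature.Combinatorics.Sahi2008
open scoped unitInterval NNReal

/-! ### The quantile transform of a probability measure on `ℝ` -/

namespace RealQuantile

variable (μ : Measure ℝ)

/-- The quantile set `{t : u ≤ F(t)}` of level `u`. [folklore] -/
def qSet (u : ℝ) : Set ℝ := {t : ℝ | u ≤ cdf μ t}

/-- Membership in the quantile set. [folklore] -/
theorem mem_qSet {u t : ℝ} : t ∈ qSet μ u ↔ u ≤ cdf μ t := Iff.rfl

/-- For `u < 1` the quantile set is nonempty (`F → 1` at `+∞`). [folklore] -/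
theorem qSet_nonempty {u : ℝ} (hu : u < 1) : (qSet μ u).Nonempty := by
  obtain ⟨t, ht⟩ := (((tendsto_order.1 (tendsto_cdf_atTop μ)).1 u hu).exists : ∃ t, u < cdf μ t)
  exact ⟨t, ht.le⟩

/-- For `0 < u` the quantile set is bounded below (`F → 0` at `−∞`). [folklore] -/
theorem bddBelow_qSet {u : ℝ} (hu : 0 < u) : BddBelow (qSet μ u) := by
  obtain ⟨t₀, ht₀⟩ := eventually_atBot.1 ((tendsto_order.1 (tendsto_cdf_atBot μ)).2 u hu)
  refine ⟨t₀, fun t ht => ?_⟩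
  by_contra hlt
  exact (lt_irrefl u) ((mem_qSet μ |>.1 ht).trans_lt (ht₀ t (not_le.1 hlt).le))

/-- **The quantile transform** `Q(u) = inf {t : u ≤ F(t)}` (meaningful for `u ∈ (0,1)`). [folklore] -/
def rq (u : ℝ) : ℝ := sInf (qSet μ u)

/-- **The quantile lies in its set** for `u < 1`: `u ≤ F(Q(u))` (right-continuity of `F`). [folklore] -/
theorem le_cdf_rq {u : ℝ} (hu1 : u < 1) : u ≤ cdf μ (rq μ u) := by
  set q : ℝ := rq μ u with hq
  have hstep : ∀ k : ℕ, u ≤ cdf μ (q + 1 / ((k : ℝ) + 1)) := by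
    intro k
    have hlt : q < q + 1 / ((k : ℝ) + 1) := by
      have : (0 : ℝ) < 1 / ((k : ℝ) + 1) := by positivity
      linarith
    obtain ⟨a, ha, hak⟩ := exists_lt_of_csInf_lt (qSet_nonempty μ hu1) hlt
    exact ((mem_qSet μ).1 ha).trans (monotone_cdf μ hak.le)
  have hseq : Tendsto (fun k : ℕ => q + 1 / ((k : ℝ) + 1)) atTop (𝓝[Ici q] q) := by
    refine tendsto_nhdsWithin_iff.2 ⟨?_, Eventually.of_forall fun k => ?_⟩
    · have h0 := (tendsto_const_div_atTop_nhds_zero_nat (1 : ℝ)).comp (tendsto_add_atTop_nat 1)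
      have h0' : Tendsto (fun k : ℕ => (1 : ℝ) / ((k : ℝ) + 1)) atTop (𝓝 0) := by
        refine h0.congr fun k => ?_
        simp only [Function.comp_apply, Nat.cast_add, Nat.cast_one]
      simpa using (tendsto_const_nhds (x := q)).add h0'
    · have : (0 : ℝ) ≤ 1 / ((k : ℝ) + 1) := by positivity
      exact Set.mem_Ici.2 (by linarith)
  exact ge_of_tendsto' (((cdf μ).right_continuous q).tendsto.comp hseq) hstep

/-- **Galois property** on `(0,1)`: `Q(u) ≤ t ↔ u ≤ F(t)`. [folklore] -/
theorem rq_le_iff {u : ℝ} (hu0 : 0 < u) (hu1 : u < 1) (t : ℝ) : rq μ u ≤ t ↔ u ≤ cdf μ t := by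
  constructor
  · intro h
    exact (le_cdf_rq μ hu1).trans (monotone_cdf μ h)
  · intro h
    exact csInf_le (bddBelow_qSet μ hu0) h

/-- The quantile transform is monotone on `(0,1)`. [folklore] -/
theorem rq_mono {u v : ℝ} (hu0 : 0 < u) (huv : u ≤ v) (hv1 : v < 1) : rq μ u ≤ rq μ v :=
  csInf_le_csInf (bddBelow_qSet μ hu0) (qSet_nonempty μ hv1) fun _ ht => huv.trans ht

/-- The quantile transform as a map from `[0,1]` (the endpoints, a Lebesgue-null set, carry junk values).
[folklore] -/
def rqI (u : I) : ℝ := rq μ u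

/-- The value of `rqI`. [folklore] -/
theorem rqI_apply (u : I) : rqI μ u = rq μ u := rfl

/-- `rqI` is monotone on the interior `(0,1)`. [folklore] -/
theorem rqI_mono_of_mem_Ioo {u v : I} (hu : (u : ℝ) ∈ Ioo 0 1) (hv : (v : ℝ) ∈ Ioo 0 1) (huv : u ≤ v) :
    rqI μ u ≤ rqI μ v :=
  rq_mono μ hu.1 (Subtype.coe_le_coe.2 huv) hv.2

/-- A point of `[0,1]` outside `(0,1)` is an endpoint (plumbing). [folklore] -/
theorem eq_zero_or_eq_one_of_not_mem_Ioo {u : I} (hu : (u : ℝ) ∉ Ioo 0 1) : u = 0 ∨ u = 1 := by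
  rcases u with ⟨x, hx0, hx1⟩
  simp only [mem_Ioo, not_and_or, not_lt] at hu
  rcases hu with h | h
  · exact Or.inl (Subtype.ext (le_antisymm h hx0))
  · exact Or.inr (Subtype.ext (le_antisymm hx1 h))

/-- **The quantile transform is measurable on `[0,1]`** (its sublevel sets are `{u ∈ (0,1) : u ≤ F(t)}` up to the
two endpoints). [folklore] -/
theorem measurable_rqI : Measurable (rqI μ) := by
  refine measurable_of_Iic fun t => ?_
  have hset : rqI μ ⁻¹' Iic t =
      {u : I | (u : ℝ) ∈ Ioo 0 1 ∧ (u : ℝ) ≤ cdf μ t} ∪ ({u : I | (u : ℝ) ∉ Ioo 0 1} ∩ rqI μ ⁻¹' Iic t) := by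
    ext u
    constructor
    · intro h
      by_cases hu : (u : ℝ) ∈ Ioo 0 1
      · exact Or.inl ⟨hu, (rq_le_iff μ hu.1 hu.2 t).1 h⟩
      · exact Or.inr ⟨hu, h⟩
    · rintro (⟨hu, h⟩ | ⟨-, h⟩)
      · exact (rq_le_iff μ hu.1 hu.2 t).2 h
      · exact h
  rw [hset]
  refine MeasurableSet.union ?_ (Set.Finite.measurableSet ?_)
  · exact (measurableSet_Ioo.preimage measurable_subtype_coe).inter
      (measurableSet_le measurable_subtype_coe measurable_const)
  · refine (Set.toFinite ({0, 1} : Set I)).subset ?_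
    rintro u ⟨hu, -⟩
    rcases eq_zero_or_eq_one_of_not_mem_Ioo hu with rfl | rfl
    · exact Or.inl rfl
    · exact Or.inr rfl

/-- **The quantile transform pushes Lebesgue measure of `[0,1]` to `μ`**: the two measures agree on every
`Iic t` — `λ{u : Q(u) ≤ t} = λ{u : u ≤ F(t)} = F(t) = μ(Iic t)`, the endpoints being null. [folklore] -/
theorem map_rqI_volume [IsProbabilityMeasure μ] : (volume : Measure I).map (rqI μ) = μ := by
  refine Measure.ext_of_Iic _ μ fun t => ?_
  rw [Measure.map_apply (measurable_rqI μ) measurableSet_Iic]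
  have hF : cdf μ t ∈ Icc (0 : ℝ) 1 := ⟨cdf_nonneg μ t, cdf_le_one μ t⟩
  have h0 : ∀ᵐ u : I ∂volume, u ≠ 0 := by
    rw [ae_iff]
    simp only [ne_eq, not_not, setOf_eq_eq_singleton, measure_singleton]
  have h1 : ∀ᵐ u : I ∂volume, u ≠ 1 := by
    rw [ae_iff]
    simp only [ne_eq, not_not, setOf_eq_eq_singleton, measure_singleton]
  have hae : (rqI μ ⁻¹' Iic t : Set I) =ᵐ[volume] (Iic ⟨cdf μ t, hF⟩ : Set I) := by
    filter_upwards [h0, h1] with u hu0 hu1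
    have hu : (u : ℝ) ∈ Ioo 0 1 := by
      by_contra hnot
      rcases eq_zero_or_eq_one_of_not_mem_Ioo hnot with h | h
      · exact hu0 h
      · exact hu1 h
    show (u ∈ rqI μ ⁻¹' Iic t) = (u ∈ Iic (⟨cdf μ t, hF⟩ : I))
    rw [Set.mem_preimage, Set.mem_Iic, Set.mem_Iic, rqI_apply, rq_le_iff μ hu.1 hu.2]
    rfl
  rw [measure_congr hae, unitInterval.volume_Iic]
  exact ofReal_cdf μ t

/-- **The quantile transform is a measure-preserving map `([0,1], λ) → (ℝ, μ)`.** [folklore] -/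
theorem measurePreserving_rqI [IsProbabilityMeasure μ] : MeasurePreserving (rqI μ) volume μ :=
  ⟨measurable_rqI μ, map_rqI_volume μ⟩

end RealQuantile

/-! ### Product probability measures on `ℝ^d` -/

variable {d n : ℕ}

/-- The coordinatewise quantile transform pushes Lebesgue measure on `Q_d` to `⊗_j μ_j` on `ℝ^d`. [folklore] -/
private theorem measurePreserving_rqPi (μ : Fin d → Measure ℝ) [∀ j, IsProbabilityMeasure (μ j)] :
    MeasurePreserving (fun (u : Fin d → I) (j : Fin d) => RealQuantile.rqI (μ j) (u j))
      (volume : Measure (Fin d → I)) (Measure.pi μ) :=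
  measurePreserving_pi (fun _ : Fin d => (volume : Measure I)) μ fun j => RealQuantile.measurePreserving_rqI (μ j)

/-- The interior of the cube has full Lebesgue measure. [folklore] -/
private theorem ae_forall_mem_Ioo :
    ∀ᵐ u : Fin d → I ∂(volume : Measure (Fin d → I)), ∀ j, ((u j : I) : ℝ) ∈ Ioo 0 1 := by
  have h : ∀ j : Fin d, ∀ᵐ u : Fin d → I ∂(volume : Measure (Fin d → I)), ((u j : I) : ℝ) ∈ Ioo 0 1 := by
    intro j
    have h0 : ∀ᵐ u : Fin d → I ∂(volume : Measure (Fin d → I)), u j ≠ 0 :=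
      Measure.ae_eval_ne (fun _ : Fin d => (volume : Measure I)) j 0
    have h1 : ∀ᵐ u : Fin d → I ∂(volume : Measure (Fin d → I)), u j ≠ 1 :=
      Measure.ae_eval_ne (fun _ : Fin d => (volume : Measure I)) j 1
    filter_upwards [h0, h1] with u hu0 hu1
    by_contra hnot
    rcases RealQuantile.eq_zero_or_eq_one_of_not_mem_Ioo hnot with h | h
    · exact hu0 h
    · exact hu1 h
  exact eventually_all.2 h

/-- **Every product probability measure on `ℝ^d`, given the continuous case**: if `LiebSahiContinuum d n` holds
then for arbitrary Borel probability measures `μ_0,…,μ_{d−1}` on `ℝ` and all BOUNDED nonnegative monotone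
increasing measurable `f_i : ℝ^d → ℝ`, `E_n(f_0,…,f_{n−1}) ≥ 0` under `μ_0 ⊗ ⋯ ⊗ μ_{d−1}` (coordinatewise quantile
transform on the open cube + monotone extension of the pulled-back family to the faces). [this work] -/
theorem msahiE_pi_real_nonneg_of_liebSahiContinuum (h : LiebSahiContinuum d n) (μ : Fin d → Measure ℝ)
    [∀ j, IsProbabilityMeasure (μ j)] (f : Fin n → (Fin d → ℝ) → ℝ) (hfm : ∀ i, Measurable (f i))
    (hf0 : ∀ i x, 0 ≤ f i x) {M : ℝ} (hfM : ∀ i x, f i x ≤ M) (hmono : ∀ i, Monotone (f i)) :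
    0 ≤ msahiE (Measure.pi μ) n f := by
  classical
  set Q : (Fin d → I) → (Fin d → ℝ) := fun u j => RealQuantile.rqI (μ j) (u j) with hQ
  rw [← msahiE_comp_measurePreserving_of_measurable (measurePreserving_rqPi μ) n f hfm]
  -- the pulled-back family, extended monotonically to the faces of the cube
  set g : Fin n → (Fin d → I) → ℝ := fun i u =>
    if ∃ j, u j = 0 then 0 else if ∃ j, u j = 1 then M else f i (Q u) with hg
  have hg_eq : ∀ i (u : Fin d → I), (∀ j, ((u j : I) : ℝ) ∈ Ioo 0 1) → g i u = f i (Q u) := by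
    intro i u hu
    have h0 : ¬ ∃ j, u j = 0 := fun ⟨j, hj⟩ => (hu j).1.ne' (by rw [hj]; rfl)
    have h1 : ¬ ∃ j, u j = 1 := fun ⟨j, hj⟩ => (hu j).2.ne (by rw [hj]; rfl)
    simp only [hg, h0, h1, if_false]
  have hmom : msahiE (volume : Measure (Fin d → I)) n (fun i => f i ∘ Q) = msahiE volume n g := by
    refine msahiE_congr_of_moments _ _ _ _ fun S => integral_congr_ae ?_
    filter_upwards [ae_forall_mem_Ioo (d := d)] with u hu
    simp only [Finset.prod_apply, Function.comp_apply, hg_eq _ u hu]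
  rw [hmom]
  -- `g` is nonnegative and monotone on the whole cube
  have hz : ∀ w : I, w ≤ 0 → w = 0 := fun w hw => le_antisymm hw w.2.1
  have ho : ∀ w : I, 1 ≤ w → w = 1 := fun w hw => le_antisymm w.2.2 hw
  refine liebSahiContinuum_iff_mSahiPositive.1 h g (fun i u => ?_) fun i u v huv => ?_
  · simp only [hg]
    split_ifs
    · exact le_rfl
    · exact (hf0 i (Q u)).trans (hfM i _)
    · exact hf0 i _
  · show g i u ≤ g i v
    simp only [hg]
    by_cases hu0 : ∃ j, u j = 0
    · rw [if_pos hu0]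
      split_ifs
      · exact le_rfl
      · exact (hf0 i (Q u)).trans (hfM i _)
      · exact hf0 i _
    · rw [if_neg hu0]
      have hv0 : ¬ ∃ j, v j = 0 := fun ⟨j, hj⟩ => hu0 ⟨j, hz (u j) (hj ▸ huv j)⟩
      rw [if_neg hv0]
      by_cases hu1 : ∃ j, u j = 1
      · obtain ⟨j, hj⟩ := hu1
        have hv1 : ∃ j, v j = 1 := ⟨j, ho (v j) (hj ▸ huv j)⟩
        rw [if_pos ⟨j, hj⟩, if_pos hv1]
      · rw [if_neg hu1]
        by_cases hv1 : ∃ j, v j = 1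
        · rw [if_pos hv1]
          exact hfM i _
        · rw [if_neg hv1]
          have hint : ∀ (w : Fin d → I), (¬ ∃ j, w j = 0) → (¬ ∃ j, w j = 1) →
              ∀ j, ((w j : I) : ℝ) ∈ Ioo 0 1 := by
            intro w h0 h1 j
            by_contra hnot
            rcases RealQuantile.eq_zero_or_eq_one_of_not_mem_Ioo hnot with h' | h'
            · exact h0 ⟨j, h'⟩
            · exact h1 ⟨j, h'⟩
          exact hmono i fun j =>
            RealQuantile.rqI_mono_of_mem_Ioo (μ j) (hint u hu0 hu1 j) (hint v hv0 hv1 j) (huv j)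

/-- The same for bounded DECREASING families (reflect every coordinate, `x ↦ −x`, which maps product measures to
product measures). [this work] -/
theorem msahiE_pi_real_nonneg_of_liebSahiContinuum_antitone (h : LiebSahiContinuum d n)
    (μ : Fin d → Measure ℝ) [∀ j, IsProbabilityMeasure (μ j)] (f : Fin n → (Fin d → ℝ) → ℝ)
    (hfm : ∀ i, Measurable (f i)) (hf0 : ∀ i x, 0 ≤ f i x) {M : ℝ} (hfM : ∀ i x, f i x ≤ M)
    (hanti : ∀ i, Antitone (f i)) : 0 ≤ msahiE (Measure.pi μ) n f := by
  set ν : Fin d → Measure ℝ := fun j => (μ j).map fun x : ℝ => -x with hν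
  haveI : ∀ j, IsProbabilityMeasure (ν j) := fun j => Measure.isProbabilityMeasure_map measurable_neg.aemeasurable
  have hmp : MeasurePreserving (fun (x : Fin d → ℝ) (j : Fin d) => -x j) (Measure.pi μ) (Measure.pi ν) :=
    measurePreserving_pi μ ν fun j => ⟨measurable_neg, rfl⟩
  have hneg : Measurable fun (x : Fin d → ℝ) (j : Fin d) => -x j :=
    measurable_pi_lambda _ fun j => (measurable_pi_apply j).neg
  have key := msahiE_pi_real_nonneg_of_liebSahiContinuum h ν (fun i x => f i fun j => -x j)
    (fun i => (hfm i).comp hneg) (fun i x => hf0 i _) (fun i x => hfM i _)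
    (fun i x y hxy => hanti i fun j => neg_le_neg (hxy j))
  rw [← msahiE_comp_measurePreserving_of_measurable hmp n (fun i x => f i fun j => -x j)
    fun i => (hfm i).comp hneg] at key
  have e : (fun i => (fun x : Fin d → ℝ => f i fun j => -x j) ∘ fun (x : Fin d → ℝ) (j : Fin d) => -x j) = f := by
    funext i x
    simp only [Function.comp_apply, neg_neg]
  rwa [e] at key

/-- **Monotone images of product measures on `ℝ^d`**: `LiebSahiContinuum d n ⇒ E_n ≥ 0` under `H_*(⊗_j μ_j)` for
every monotone measurable `H : ℝ^d → Ω` into a measurable preorder and all bounded nonnegative monotone measurable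
families on `Ω`. [this work] -/
theorem msahiE_map_pi_real_nonneg_of_liebSahiContinuum (h : LiebSahiContinuum d n) (μ : Fin d → Measure ℝ)
    [∀ j, IsProbabilityMeasure (μ j)] {Ω : Type*} [MeasurableSpace Ω] [Preorder Ω] {H : (Fin d → ℝ) → Ω}
    (hHm : Measurable H) (hH : Monotone H) (f : Fin n → Ω → ℝ) (hfm : ∀ i, Measurable (f i))
    (hf0 : ∀ i x, 0 ≤ f i x) {M : ℝ} (hfM : ∀ i x, f i x ≤ M) (hmono : ∀ i, Monotone (f i)) :
    0 ≤ msahiE ((Measure.pi μ).map H) n f := by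
  have hmp : MeasurePreserving H (Measure.pi μ) ((Measure.pi μ).map H) := ⟨hHm, rfl⟩
  rw [← msahiE_comp_measurePreserving_of_measurable hmp n f hfm]
  exact msahiE_pi_real_nonneg_of_liebSahiContinuum h μ _ (fun i => (hfm i).comp hHm) (fun i x => hf0 i _)
    (fun i x => hfM i _) fun i x y hxy => hmono i (hH hxy)

/-! ### Unconditionally: `d ≤ 2` — product measures on `ℝ` and on `ℝ²` -/

/-- **Every product probability measure on `ℝ^d`, `d ≤ 2`, is Sahi-positive of every order for bounded measurable
families.** [this work] -/
theorem msahiE_pi_real_nonneg_of_le_two (hd : d ≤ 2) (μ : Fin d → Measure ℝ)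
    [∀ j, IsProbabilityMeasure (μ j)] (n : ℕ) (f : Fin n → (Fin d → ℝ) → ℝ) (hfm : ∀ i, Measurable (f i))
    (hf0 : ∀ i x, 0 ≤ f i x) {M : ℝ} (hfM : ∀ i x, f i x ≤ M) (hmono : ∀ i, Monotone (f i)) :
    0 ≤ msahiE (Measure.pi μ) n f :=
  msahiE_pi_real_nonneg_of_liebSahiContinuum (liebSahiContinuum_of_le_two hd n) μ f hfm hf0 hfM hmono

/-- **Every product probability measure `μ₁ ⊗ μ₂` on `ℝ²` is Sahi-positive of every order** (increasing form):
for arbitrary Borel probability measures `μ₁, μ₂` on `ℝ` and all bounded nonnegative monotone increasing measurable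
`f_0,…,f_{n−1} : ℝ² → ℝ`, `E_n(f_0,…,f_{n−1}) ≥ 0` under `μ₁ ⊗ μ₂`. [this work] -/
theorem msahiE_prod_real_nonneg_of_monotone (μ₁ μ₂ : Measure ℝ) [IsProbabilityMeasure μ₁]
    [IsProbabilityMeasure μ₂] (n : ℕ) (f : Fin n → ℝ × ℝ → ℝ) (hfm : ∀ i, Measurable (f i))
    (hf0 : ∀ i p, 0 ≤ f i p) {M : ℝ} (hfM : ∀ i p, f i p ≤ M) (hmono : ∀ i, Monotone (f i)) :
    0 ≤ msahiE (μ₁.prod μ₂) n f := by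
  haveI : ∀ j, IsProbabilityMeasure (![μ₁, μ₂] j) := Fin.forall_fin_two.2 ⟨‹_›, ‹_›⟩
  have he := measurePreserving_finTwoArrow_vec μ₁ μ₂
  rw [← msahiE_comp_measurePreserving he MeasurableEquiv.finTwoArrow.measurableEmbedding n f]
  refine msahiE_pi_real_nonneg_of_le_two le_rfl ![μ₁, μ₂] n _
    (fun i => (hfm i).comp MeasurableEquiv.finTwoArrow.measurable) (fun i x => hf0 i _) (fun i x => hfM i _)
    fun i x y hxy => ?_
  exact hmono i ⟨hxy 0, hxy 1⟩

/-- **Every product probability measure on `ℝ²`, decreasing form.** [this work] -/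
theorem msahiE_prod_real_nonneg_of_antitone (μ₁ μ₂ : Measure ℝ) [IsProbabilityMeasure μ₁]
    [IsProbabilityMeasure μ₂] (n : ℕ) (f : Fin n → ℝ × ℝ → ℝ) (hfm : ∀ i, Measurable (f i))
    (hf0 : ∀ i p, 0 ≤ f i p) {M : ℝ} (hfM : ∀ i p, f i p ≤ M) (hanti : ∀ i, Antitone (f i)) :
    0 ≤ msahiE (μ₁.prod μ₂) n f := by
  haveI : ∀ j, IsProbabilityMeasure (![μ₁, μ₂] j) := Fin.forall_fin_two.2 ⟨‹_›, ‹_›⟩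
  have he := measurePreserving_finTwoArrow_vec μ₁ μ₂
  rw [← msahiE_comp_measurePreserving he MeasurableEquiv.finTwoArrow.measurableEmbedding n f]
  refine msahiE_pi_real_nonneg_of_liebSahiContinuum_antitone (liebSahiContinuum_two n) ![μ₁, μ₂] _
    (fun i => (hfm i).comp MeasurableEquiv.finTwoArrow.measurable) (fun i x => hf0 i _) (fun i x => hfM i _)
    fun i x y hxy => ?_
  exact hanti i ⟨hxy 0, hxy 1⟩

/-- **Monotone images of product measures on `ℝ²`** are Sahi-positive of every order for bounded measurable
families (unconditional). [this work] -/
theorem msahiE_map_prod_real_nonneg {Ω : Type*} [MeasurableSpace Ω] [Preorder Ω] (μ₁ μ₂ : Measure ℝ)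
    [IsProbabilityMeasure μ₁] [IsProbabilityMeasure μ₂] {H : ℝ × ℝ → Ω} (hHm : Measurable H)
    (hH : Monotone H) (n : ℕ) (f : Fin n → Ω → ℝ) (hfm : ∀ i, Measurable (f i)) (hf0 : ∀ i x, 0 ≤ f i x)
    {M : ℝ} (hfM : ∀ i x, f i x ≤ M) (hmono : ∀ i, Monotone (f i)) :
    0 ≤ msahiE ((μ₁.prod μ₂).map H) n f := by
  have hmp : MeasurePreserving H (μ₁.prod μ₂) ((μ₁.prod μ₂).map H) := ⟨hHm, rfl⟩
  rw [← msahiE_comp_measurePreserving_of_measurable hmp n f hfm]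
  exact msahiE_prod_real_nonneg_of_monotone μ₁ μ₂ n _ (fun i => (hfm i).comp hHm) (fun i x => hf0 i _)
    (fun i x => hfM i _) fun i x y hxy => hmono i (hH hxy)

/-! ### Gaussian vectors with nonnegative loadings -/

/-- **Gaussian vectors `X = A Z + c` with entrywise nonnegative `A`**: for independent Gaussians
`Z_j ~ N(m_j, v_j)` (`j < d`), a `k × d` matrix `A ≥ 0` entrywise and `c ∈ ℝ^k`, the law of `X = A Z + c` is a
monotone image of a product measure on `ℝ^d`; hence `LiebSahiContinuum d n ⇒ E_n(f_0,…,f_{n−1}) ≥ 0` for all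
bounded nonnegative monotone measurable `f_i : ℝ^k → ℝ`. [this work] -/
theorem msahiE_gaussian_mulVec_nonneg_of_liebSahiContinuum (h : LiebSahiContinuum d n) {k : ℕ}
    (A : Matrix (Fin k) (Fin d) ℝ) (hA : ∀ i j, 0 ≤ A i j) (c : Fin k → ℝ) (m : Fin d → ℝ) (v : Fin d → ℝ≥0)
    (f : Fin n → (Fin k → ℝ) → ℝ) (hfm : ∀ i, Measurable (f i)) (hf0 : ∀ i x, 0 ≤ f i x) {M : ℝ}
    (hfM : ∀ i x, f i x ≤ M) (hmono : ∀ i, Monotone (f i)) :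
    0 ≤ msahiE ((Measure.pi fun j => gaussianReal (m j) (v j)).map fun z => A.mulVec z + c) n f := by
  refine msahiE_map_pi_real_nonneg_of_liebSahiContinuum h _ ?_ ?_ f hfm hf0 hfM hmono
  · exact ((continuous_const.matrix_mulVec continuous_id).add continuous_const).measurable
  · intro z z' hzz' i
    simp only [Pi.add_apply, Matrix.mulVec, dotProduct]
    exact add_le_add (Finset.sum_le_sum fun j _ => mul_le_mul_of_nonneg_left (hzz' j) (hA i j)) le_rfl

/-- **Unconditionally, two sources**: every Gaussian vector `X = A Z + c ∈ ℝ^k` driven by `d ≤ 2` independent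
Gaussians through an entrywise nonnegative `k × d` matrix satisfies `E_n ≥ 0` for every `n` and all bounded
nonnegative monotone measurable families. [this work] -/
theorem msahiE_gaussian_mulVec_nonneg_of_le_two (hd : d ≤ 2) {k : ℕ} (A : Matrix (Fin k) (Fin d) ℝ)
    (hA : ∀ i j, 0 ≤ A i j) (c : Fin k → ℝ) (m : Fin d → ℝ) (v : Fin d → ℝ≥0) (n : ℕ)
    (f : Fin n → (Fin k → ℝ) → ℝ) (hfm : ∀ i, Measurable (f i)) (hf0 : ∀ i x, 0 ≤ f i x) {M : ℝ}
    (hfM : ∀ i x, f i x ≤ M) (hmono : ∀ i, Monotone (f i)) :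
    0 ≤ msahiE ((Measure.pi fun j => gaussianReal (m j) (v j)).map fun z => A.mulVec z + c) n f :=
  msahiE_gaussian_mulVec_nonneg_of_liebSahiContinuum (liebSahiContinuum_of_le_two hd n) A hA c m v f hfm hf0
    hfM hmono

/-- **Every bivariate Gaussian with nonnegative correlation is Sahi-positive of every order**: for Gaussians
`Z₁ ~ N(m₁, v₁)`, `Z₂ ~ N(m₂, v₂)` independent and `a, b ≥ 0`, the law of `(Z₁, a Z₁ + b Z₂)` — for
`m = 0, v = 1, a = ρ, b = √(1 − ρ²)` the standard bivariate normal with correlation `ρ ∈ [0,1]` — satisfies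
`E_n(f_0,…,f_{n−1}) ≥ 0` for every `n` and all bounded nonnegative monotone increasing measurable
`f_i : ℝ² → ℝ` (Pitt's association theorem is the order `n = 2`). [this work] -/
theorem msahiE_bivariateGaussian_nonneg (m₁ m₂ : ℝ) (v₁ v₂ : ℝ≥0) {a b : ℝ} (ha : 0 ≤ a) (hb : 0 ≤ b)
    (n : ℕ) (f : Fin n → ℝ × ℝ → ℝ) (hfm : ∀ i, Measurable (f i)) (hf0 : ∀ i p, 0 ≤ f i p) {M : ℝ}
    (hfM : ∀ i p, f i p ≤ M) (hmono : ∀ i, Monotone (f i)) :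
    0 ≤ msahiE (((gaussianReal m₁ v₁).prod (gaussianReal m₂ v₂)).map
      fun p : ℝ × ℝ => (p.1, a * p.1 + b * p.2)) n f :=
  msahiE_map_prod_real_nonneg _ _ (H := fun p : ℝ × ℝ => (p.1, a * p.1 + b * p.2))
    (measurable_fst.prodMk ((measurable_fst.const_mul a).add (measurable_snd.const_mul b)))
    (fun _ _ hpq => Prod.mk_le_mk.2
      ⟨hpq.1, add_le_add (mul_le_mul_of_nonneg_left hpq.1 ha) (mul_le_mul_of_nonneg_left hpq.2 hb)⟩)
    n f hfm hf0 hfM hmono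

end Summit.CriticalPhenomena.PercolationContinuityZ3.Theorems
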